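import Summits.QuantumFields.YangMills.Theorems.ContractibleFibreFibreToTorusEnergyGeometry
import Summits.QuantumFields.YangMills.Theorems.ContractibleFibreFibreToTorusStubTubeLimitState
import Summits.QuantumFields.YangMills.Theorems.ContractibleFibreFibreToTorusTangentJensen
import Summits.QuantumFields.YangMills.Theorems.ContractibleFibreFibreToTorusTangentBoundary
import Summits.QuantumFields.YangMills.Theorems.ContractibleFibreFibreToTorusTangentCounting
import Summits.QuantumFields.YangMills.Theorems.ContractibleFibreFibreToTorusTangentCylinder
import Summits.QuantumFields.YangMills.Theorems.ContractibleFibreFibreToTorusTangentTranslates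
import Literature.MathematicalPhysics.QuantumLattice.LatticeGaugeDLRFreeEnergyProofs
import Literature.MathematicalPhysics.QuantumFieldTheory.LatticeGaugeShenZhuZhuProofs
import Literature.Probability.LatticeModels.GibbsSpecificationDLRProofs
import HarnessLib

/-!
# Unique tangent of the pressure ⇒ translation-invariant DLR states agree (stub `stub_tangentBridge`)

Stub (Bridge) of crux `FibreToTorus` (stmt-QuantumFields-16244), line `Sketch` (ergodic-selection cut, tangent reshape
NS → PTU → Bridge → V): for the Wilson lattice gauge theory of a compact Hausdorff second-countable group `G` in a
continuous matrix representation `ρ` on `ℤ^d`, every `β` and every bounded measurable gauge-invariant cylinder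
observable `A`: IF the perturbed free-box log-partition functions
`D_n(λ) = log ∫ exp(-β S_{𝔅_n}(U) + λ ∑_{x ∈ X_n^A} A(τ_x U)) dg_∞(U) - log ∫ exp(-β S_{𝔅_n}) dg_∞` have `ε`-close
one-sided difference quotients `D_n(λ₊)/(λ₊ (n+1)^d) - D_n(λ₋)/(λ₋ (n+1)^d) ≤ ε` eventually in `n`, for some
`λ₊ > 0 > λ₋` depending on `ε` (pressure tangent uniqueness at `(β, A)`, Israel's unique-tangent condition in a
limit-free form), THEN any two translation-invariant DLR states of `ymSpecification ρ β` have the same expectation of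
`A` — Israel, *Convexity in the Theory of Lattice Gases*, Thm. III.2.1 / Cor. II.1.3 (tangent functionals to the
pressure at `βΦ_W` restricted to gauge-invariant local directions ⇄ translation-invariant Gibbs expectations),
forward direction; Friedli–Velenik 2017 Prop. 6.91 (6.117) for a general local observable.

Proof (assembly of the landed helpers T1 `tangent_logNormaliser_jensen`, T2 `tangent_abs_logNormaliser_sub_logFree_le`,
T4 `tangent_card_goodSites_tendsto`, T4b `tangent_perturbation_cylinder`, T5 `tangent_integral_sum_translates` and E4
`energy_box_geometry`): for a translation-invariant DLR state `κ` and real `λ`, in the edge box `Λ_{n+1}` and for every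
boundary condition `η`, Jensen in the perturbation gives `log N^η(λΨ_n) - log N^η(0) ≥ λ ⟨Ψ_n⟩^η_{β,Λ}` (T1); both
normalisers are within `R_n = |β|(N+M)#∂` of the free-box perturbed / unperturbed partition functions, the perturbation
`Ψ_n = ∑_{x ∈ X_n^A} A∘τ_x` being a cylinder function of `Λ_{n+1}` (T2, T4b); integrating against `κ(dη)` the DLR
equations and translation invariance give `∫⟨Ψ_n⟩^η dκ = ⟨Ψ_n⟩_κ = #X_n^A ⟨A⟩_κ` (T5); hence
`(★) λ #X_n^A ⟨A⟩_κ ≤ D_n(λ) + 2 R_n`.  Dividing `(★)` at `λ₊` for `κ₁` by `λ₊(n+1)^d > 0` and at `λ₋` for `κ₂` by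
`λ₋(n+1)^d < 0` and subtracting, `(⟨A⟩_{κ₁} - ⟨A⟩_{κ₂}) #X_n^A/(n+1)^d ≤ ε + (2/λ₊ - 2/λ₋) R_n/(n+1)^d`; as
`#X_n^A/(n+1)^d → 1` (T4) and `R_n/(n+1)^d → 0` (E4), `⟨A⟩_{κ₁} - ⟨A⟩_{κ₂} ≤ ε` for every `ε > 0`, and by symmetry the two
expectations coincide.
-/

noncomputable section

open MeasureTheory Filter Topology Finset
open Literature.Probability.LatticeModels (Site halfOpenBox glueWith IsGibbsMeasure)
open Literature.MathematicalPhysics.QuantumLattice (LGConfig ZdEdge ZdPlaquette plaquetteObs plaquetteEdges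
  plaquettesTouching wilsonBoundaryAction ymSpecification ymGibbsMeasures IsZdTranslationInvariant
  freeEnergyDensity configShift LocalGaugeObservable IsCylinder
  abs_integral_ymSpecification_le integrable_of_bound)
open Literature.MathematicalPhysics.QuantumFieldTheory (haarProbability zdHaar
  isSpecification_ymSpecification_of_t2Space exists_bound_trace_re_nonneg)

namespace Summit.QuantumFields.YangMills.Theorems.FibreToTorus

/-- **Stub (Bridge) `stub_tangentBridge` of line `Sketch`** (registered signature, verbatim): pressure tangent
uniqueness at `(β, A)` forces all translation-invariant DLR states of the Wilson specification at `β` to agree on the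
local gauge-invariant observable `A` (Israel Thm. III.2.1, forward direction, for lattice gauge theory).
[cite: FriedliVelenik2017, Prop. 6.91 (6.117)] -/
theorem stub_tangentBridge : ∀ (d N : ℕ) (G : Type) [Group G] [TopologicalSpace G] [IsTopologicalGroup G] [CompactSpace G] [MeasurableSpace G] [BorelSpace G] [SecondCountableTopology G] [T2Space G] (ρ : G →* Matrix (Fin N) (Fin N) ℂ), Continuous ρ → ∀ (β : ℝ) (A : LocalGaugeObservable d G), (∀ ε : ℝ, 0 < ε → ∃ lp : ℝ, 0 < lp ∧ ∃ lm : ℝ, lm < 0 ∧ ∃ n₀ : ℕ, ∀ n : ℕ, n₀ ≤ n → (Real.log (∫ U, Real.exp (-β * (∑ p ∈ (halfOpenBox d n ×ˢ (Finset.univ : Finset {q : Fin d × Fin d // q.1 < q.2})), ((N : ℝ) - plaquetteObs ρ p.1 p.2.1.1 p.2.1.2 U)) + lp * ∑ x ∈ (halfOpenBox d n).filter (fun x => A.supp.image (fun e => (e.1 + x, e.2)) ⊆ halfOpenBox d (n + 1) ×ˢ (Finset.univ : Finset (Fin d))), A.F (configShift (-x) U)) ∂(zdHaar d G)) - Real.log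 (∫ U, Real.exp (-β * (∑ p ∈ (halfOpenBox d n ×ˢ (Finset.univ : Finset {q : Fin d × Fin d // q.1 < q.2})), ((N : ℝ) - plaquetteObs ρ p.1 p.2.1.1 p.2.1.2 U))) ∂(zdHaar d G))) / (lp * ((n : ℝ) + 1) ^ d) - (Real.log (∫ U, Real.exp (-β * (∑ p ∈ (halfOpenBox d n ×ˢ (Finset.univ : Finset {q : Fin d × Fin d // q.1 < q.2})), ((N : ℝ) - plaquetteObs ρ p.1 p.2.1.1 p.2.1.2 U)) + lm * ∑ x ∈ (halfOpenBox d n).filter (fun x => A.supp.image (fun e => (e.1 + x, e.2)) ⊆ halfOpenBox d (n + 1) ×ˢ (Finset.univ : Finset (Fin d))), A.F (configShift (-x) U)) ∂(zdHaar d G)) - Real.log (∫ U, Real.exp (-β * (∑ p ∈ (halfOpenBox d n ×ˢ (Finset.univ : Finset {q : Fin d × Fin d // q.1 < q.2})), ((N : ℝ) - plaquetteObs ρ p.1 p.2.1.1 p.2.1.2 U))) ∂(zdHaar d G))) / (lm * ((n : ℝ) + 1) ^ d) ≤ ε) → ∀ (μ ν : MeasureTheory.Measure (LGConfig d G)), μ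 ∈ ymGibbsMeasures (d := d) ρ β → ν ∈ ymGibbsMeasures (d := d) ρ β → IsZdTranslationInvariant μ → IsZdTranslationInvariant ν → ∫ U, A.F U ∂μ = ∫ U, A.F U ∂ν := by
  have hT1 := tangent_logNormaliser_jensen
  have hT2 := tangent_abs_logNormaliser_sub_logFree_le
  have hT4 := tangent_card_goodSites_tendsto
  have hT4b := tangent_perturbation_cylinder
  have hT5 := tangent_integral_sum_translates
  intro d N G _ _ _ _ _ _ _ _ ρ hρ β A hPTU
  classical
  -- it suffices to prove `≤` for every ordered pair of states
  suffices hle : ∀ (κ₁ κ₂ : Measure (LGConfig d G)), κ₁ ∈ ymGibbsMeasures (d := d) ρ β →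
      κ₂ ∈ ymGibbsMeasures (d := d) ρ β → IsZdTranslationInvariant κ₁ → IsZdTranslationInvariant κ₂ →
      ∫ U, A.F U ∂κ₁ ≤ ∫ U, A.F U ∂κ₂ by
    intro μ ν hμ hν hμT hνT
    exact le_antisymm (hle μ ν hμ hν hμT hνT) (hle ν μ hν hμ hνT hμT)
  intro κ₁ κ₂ hκ₁ hκ₂ hκ₁T hκ₂T
  have hκ₁G : IsGibbsMeasure (ymSpecification ρ β) κ₁ := hκ₁
  have hκ₂G : IsGibbsMeasure (ymSpecification ρ β) κ₂ := hκ₂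
  haveI : IsProbabilityMeasure κ₁ := hκ₁G.isProbabilityMeasure
  haveI : IsProbabilityMeasure κ₂ := hκ₂G.isProbabilityMeasure
  obtain ⟨M, hM0, hM⟩ := exists_bound_trace_re_nonneg ρ hρ
  obtain ⟨CA, hCA⟩ := A.bounded
  -- notation
  let B : ℕ → Finset (ZdPlaquette d) := fun n =>
    halfOpenBox d n ×ˢ (Finset.univ : Finset {q : Fin d × Fin d // q.1 < q.2})
  let Λ : ℕ → Finset (ZdEdge d) := fun n => halfOpenBox d (n + 1) ×ˢ (Finset.univ : Finset (Fin d))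
  let X : ℕ → Finset (Site d) := fun n =>
    (halfOpenBox d n).filter (fun x => A.supp.image (fun e => (e.1 + x, e.2)) ⊆ Λ n)
  let Ψ : ℕ → LGConfig d G → ℝ := fun n U => ∑ x ∈ X n, A.F (configShift (-x) U)
  let S : ℕ → LGConfig d G → ℝ := fun n U => ∑ p ∈ B n, ((N : ℝ) - plaquetteObs ρ p.1 p.2.1.1 p.2.1.2 U)
  let Zf : ℕ → ℝ → ℝ := fun n lam => ∫ U, Real.exp (-β * S n U + lam * Ψ n U) ∂(zdHaar d G)
  let Z0 : ℕ → ℝ := fun n => ∫ U, Real.exp (-β * S n U) ∂(zdHaar d G)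
  let R : ℕ → ℝ := fun n => |β| * (N + M) * (#(plaquettesTouching (Λ n) \ B n) : ℝ)
  set a₁ : ℝ := ∫ U, A.F U ∂κ₁ with ha₁
  set a₂ : ℝ := ∫ U, A.F U ∂κ₂ with ha₂
  -- geometry of the boxes (landed E4)
  have hgeo := energy_box_geometry d
  -- (★) the finite-volume inequality for a translation-invariant DLR state and any `lam`
  have star : ∀ (κ : Measure (LGConfig d G)), IsGibbsMeasure (ymSpecification ρ β) κ →
      IsZdTranslationInvariant κ → ∀ (n : ℕ) (lam : ℝ),
      lam * (#(X n) : ℝ) * (∫ U, A.F U ∂κ) ≤ (Real.log (Zf n lam) - Real.log (Z0 n)) + 2 * R n := by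
    intro κ hκG hκT n lam
    haveI : IsProbabilityMeasure κ := hκG.isProbabilityMeasure
    obtain ⟨hBsub, hBedges, -⟩ := hgeo n
    obtain ⟨hΨm, hΨcyl, CΨ, hCΨ⟩ := hT4b d G A n
    -- the scaled perturbation
    have hΦm : Measurable (fun U : LGConfig d G => lam * Ψ n U) := measurable_const.mul hΨm
    have hΦb : ∃ C : ℝ, ∀ U : LGConfig d G, |lam * Ψ n U| ≤ C :=
      ⟨|lam| * CΨ, fun U => by rw [abs_mul]; exact mul_le_mul_of_nonneg_left (hCΨ U) (abs_nonneg _)⟩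
    have hΦcyl : IsCylinder (fun U : LGConfig d G => lam * Ψ n U) (Λ n) := fun U V h =>
      congrArg (fun t : ℝ => lam * t) (hΨcyl h)
    -- T1 (Jensen) and T2 (boundary) for every boundary condition
    have hpt : ∀ η : LGConfig d G,
        Real.log (Z0 n) - R n + lam * ∫ U, Ψ n U ∂(ymSpecification ρ β (Λ n) η) ≤
          Real.log (Zf n lam) + R n := by
      intro η
      have h1 := hT1 d N G ρ hρ (Λ n) η β (fun U => lam * Ψ n U) hΦm hΦb
      rw [integral_const_mul] at h1
      have h2 := abs_sub_le_iff.1 (hT2 d N G ρ hρ M hM (Λ n) (B n) hBsub hBedges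
        (fun U => lam * Ψ n U) (Λ n) hΦm hΦb hΦcyl (Finset.Subset.refl _) η β)
      have h0 := hT2 d N G ρ hρ M hM (Λ n) (B n) hBsub hBedges (fun _ => (0 : ℝ)) ∅ measurable_const
        ⟨0, fun _ => by simp⟩ (fun _ _ _ => rfl) (Finset.empty_subset _) η β
      simp only [add_zero] at h0
      have h0' := abs_sub_le_iff.1 h0
      linarith [h2.1, h2.2, h0'.1, h0'.2]
    -- integrate against `κ(dη)` and use the DLR equations + translation invariance
    have hγi : Integrable (fun η => ∫ U, Ψ n U ∂(ymSpecification ρ β (Λ n) η)) κ :=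
      integrable_of_bound (measurable_integral_ymSpecification ρ hρ β (Λ n) hΨm).aestronglyMeasurable
        (abs_integral_ymSpecification_le ρ hρ β (Λ n) hCΨ)
    have hDLR : ∫ η, (∫ U, Ψ n U ∂(ymSpecification ρ β (Λ n) η)) ∂κ = ∫ U, Ψ n U ∂κ :=
      hκG.integral_integral_eq (isSpecification_ymSpecification_of_t2Space ρ hρ β) (Λ n)
        (integrable_of_bound hΨm.aestronglyMeasurable hCΨ)
    have hT5' : ∫ U, Ψ n U ∂κ = #(X n) * ∫ U, A.F U ∂κ :=
      hT5 d G κ inferInstance hκT A.F A.measurable A.bounded (X n)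
    have hi1 : Integrable (fun η : LGConfig d G => Real.log (Z0 n) - R n +
        lam * ∫ U, Ψ n U ∂(ymSpecification ρ β (Λ n) η)) κ :=
      (integrable_const _).add (hγi.const_mul lam)
    have hmono := integral_mono hi1 (integrable_const _) hpt
    rw [integral_add (integrable_const _) (hγi.const_mul _), integral_const_mul, hDLR, hT5',
      integral_const, integral_const] at hmono
    simp only [probReal_univ, smul_eq_mul, one_mul] at hmono
    nlinarith [hmono]
  -- limits of the error terms
  have hpos : ∀ n : ℕ, (0 : ℝ) < ((n : ℝ) + 1) ^ d := fun n => by positivity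
  have hR : Tendsto (fun n : ℕ => R n / (((n : ℝ) + 1) ^ d)) atTop (𝓝 0) := by
    set D : ℝ := (Fintype.card {q : Fin d × Fin d // q.1 < q.2} : ℝ) with hD
    have hup : ∀ n : ℕ, R n / (((n : ℝ) + 1) ^ d) ≤
        |β| * (N + M) * (D * ((((n : ℝ) + 2) / ((n : ℝ) + 1)) ^ d - (((n : ℝ)) / ((n : ℝ) + 1)) ^ d)) := by
      intro n
      obtain ⟨-, -, hcard⟩ := hgeo n
      have hn1' : ((n : ℝ) + 1) ^ d ≠ 0 := (hpos n).ne'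
      rw [div_pow, div_pow, ← sub_div, div_le_iff₀ (hpos n)]
      calc R n = |β| * (N + M) * (#(plaquettesTouching (Λ n) \ B n) : ℝ) := rfl
        _ ≤ |β| * (N + M) * (D * (((n : ℝ) + 2) ^ d - (n : ℝ) ^ d)) :=
            mul_le_mul_of_nonneg_left hcard (by positivity)
        _ = |β| * (N + M) * (D * ((((n : ℝ) + 2) ^ d - (n : ℝ) ^ d) / ((n : ℝ) + 1) ^ d)) *
              ((n : ℝ) + 1) ^ d := by field_simp
    have hlow : ∀ n : ℕ, 0 ≤ R n / (((n : ℝ) + 1) ^ d) := fun n =>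
      div_nonneg (by positivity) (hpos n).le
    have h1 : Tendsto (fun n : ℕ => ((n : ℝ) + 2) / ((n : ℝ) + 1)) atTop (𝓝 1) := by
      have h : Tendsto (fun n : ℕ => 1 + 1 / ((n : ℝ) + 1)) atTop (𝓝 (1 + 0)) :=
        tendsto_const_nhds.add (tendsto_one_div_add_atTop_nhds_zero_nat)
      rw [add_zero] at h
      refine h.congr fun n => ?_
      have : (n : ℝ) + 1 ≠ 0 := by positivity
      field_simp
      ring
    have h2 : Tendsto (fun n : ℕ => (n : ℝ) / ((n : ℝ) + 1)) atTop (𝓝 1) := by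
      have h : Tendsto (fun n : ℕ => 1 - 1 / ((n : ℝ) + 1)) atTop (𝓝 (1 - 0)) :=
        tendsto_const_nhds.sub (tendsto_one_div_add_atTop_nhds_zero_nat)
      rw [sub_zero] at h
      refine h.congr fun n => ?_
      have : (n : ℝ) + 1 ≠ 0 := by positivity
      field_simp
      ring
    have h3 : Tendsto (fun n : ℕ => |β| * (N + M) * (D * ((((n : ℝ) + 2) / ((n : ℝ) + 1)) ^ d -
        (((n : ℝ)) / ((n : ℝ) + 1)) ^ d))) atTop (𝓝 (|β| * (N + M) * (D * (1 ^ d - 1 ^ d)))) :=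
      (((h1.pow d).sub (h2.pow d)).const_mul D).const_mul _
    rw [sub_self, mul_zero, mul_zero] at h3
    exact tendsto_of_tendsto_of_tendsto_of_le_of_le tendsto_const_nhds h3 hlow hup
  have hr : Tendsto (fun n : ℕ => (#(X n) : ℝ) / (((n : ℝ) + 1) ^ d)) atTop (𝓝 1) := hT4 d A.supp
  -- the ε-argument
  refine le_of_forall_pos_le_add fun ε hε => ?_
  obtain ⟨lp, hlp, lm, hlm, n₀, hn₀⟩ := hPTU ε hε
  -- eventually: a₁ r_n ≤ Qp_n + 2R_n/(lp (n+1)^d) and a₂ r_n ≥ Qm_n + 2 R_n/(lm (n+1)^d)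
  have hL : Tendsto (fun n : ℕ => (a₁ - a₂) * ((#(X n) : ℝ) / (((n : ℝ) + 1) ^ d)) -
      (2 / lp - 2 / lm) * (R n / (((n : ℝ) + 1) ^ d))) atTop (𝓝 ((a₁ - a₂) * 1 - (2 / lp - 2 / lm) * 0)) :=
    (hr.const_mul _).sub (hR.const_mul _)
  rw [mul_one, mul_zero, sub_zero] at hL
  suffices key : a₁ - a₂ ≤ ε by linarith
  refine le_of_tendsto_of_tendsto hL tendsto_const_nhds ?_
  filter_upwards [eventually_ge_atTop n₀] with n hn
  have hq := hn₀ n hn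
  have hnd : (0 : ℝ) < ((n : ℝ) + 1) ^ d := hpos n
  have s1 := star κ₁ hκ₁G hκ₁T n lp
  have s2 := star κ₂ hκ₂G hκ₂T n lm
  -- divide (★) by `lp (n+1)^d > 0`, resp. `lm (n+1)^d < 0`
  have hlpn : 0 < lp * ((n : ℝ) + 1) ^ d := mul_pos hlp hnd
  have hlmn : lm * ((n : ℝ) + 1) ^ d < 0 := mul_neg_of_neg_of_pos hlm hnd
  set P : ℝ := ((n : ℝ) + 1) ^ d with hPdef
  set Xc : ℝ := (#(X n) : ℝ) with hXc
  set Dp : ℝ := Real.log (Zf n lp) - Real.log (Z0 n) with hDp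
  set Dm : ℝ := Real.log (Zf n lm) - Real.log (Z0 n) with hDm
  have hlm' : 0 < -lm := neg_pos.2 hlm
  -- (★) divided by `lp P > 0`
  have h1 : Xc * a₁ / P ≤ (Dp + 2 * R n) / (lp * P) := by
    rw [div_le_div_iff₀ hnd (mul_pos hlp hnd)]
    calc Xc * a₁ * (lp * P) = (lp * Xc * a₁) * P := by ring
      _ ≤ (Dp + 2 * R n) * P := mul_le_mul_of_nonneg_right s1 hnd.le
  -- (★) divided by `lm P < 0`
  have h2 : (Dm + 2 * R n) / (lm * P) ≤ Xc * a₂ / P := by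
    have hrw : (Dm + 2 * R n) / (lm * P) = (-(Dm + 2 * R n)) / ((-lm) * P) := by
      rw [neg_mul, neg_div_neg_eq]
    rw [hrw, div_le_div_iff₀ (mul_pos hlm' hnd) hnd]
    calc -(Dm + 2 * R n) * P = -((Dm + 2 * R n) * P) := by ring
      _ ≤ -((lm * Xc * a₂) * P) := neg_le_neg (mul_le_mul_of_nonneg_right s2 hnd.le)
      _ = Xc * a₂ * (-lm * P) := by ring
  have h1' : Xc * a₁ / P ≤ Dp / (lp * P) + 2 * (R n / (lp * P)) := by
    have : (Dp + 2 * R n) / (lp * P) = Dp / (lp * P) + 2 * (R n / (lp * P)) := by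
      rw [add_div, mul_div_assoc]
    rw [← this]; exact h1
  have h2' : Dm / (lm * P) + 2 * (R n / (lm * P)) ≤ Xc * a₂ / P := by
    have : (Dm + 2 * R n) / (lm * P) = Dm / (lm * P) + 2 * (R n / (lm * P)) := by
      rw [add_div, mul_div_assoc]
    rw [← this]; exact h2
  have hq' : Dp / (lp * P) - Dm / (lm * P) ≤ ε := hq
  have hgoal : (a₁ - a₂) * (Xc / P) - (2 / lp - 2 / lm) * (R n / P) =
      Xc * a₁ / P - Xc * a₂ / P - 2 * (R n / (lp * P)) + 2 * (R n / (lm * P)) := by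
    field_simp
    ring
  rw [hgoal]
  linarith [h1', h2', hq']

end Summit.QuantumFields.YangMills.Theorems.FibreToTorus

end
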